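import Literature.AlgebraicGeometry.Frobenioids.ArchimedeanRCConnected
import Literature.AlgebraicGeometry.Frobenioids.ArchimedeanBaseComparison
import Literature.AlgebraicGeometry.Frobenioids.ArchimedeanFSM
import HarnessLib

/-!
# Frobenioids II, Proposition 3.4 (viii), first sentence of the proof: `F` is complexifiable,
# RC-connected and totally epimorphic (abc-iut cell, layer L1, sub-node `FrdII:Prop3.4(viii)/P34-L09`
# `FComplexifiableRCConnectedTotEpi` of `plan/L1/SUBDAG-FrdII-Prop34.md`, chain LC-L1-2)

Mochizuki, *The geometry of Frobenioids II: poly-Frobenioids*, Kyushu J. Math. **62** (2008)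
401–460, §3, Proposition 3.4 (viii) p. 30, proof p. 32 ll. 2–4: "It is immediate from the definition
of `F` that `F` is complexifiable, RC-connected [hence, in particular, connected] and totally
epimorphic." [cite: MochizukiFrdII2008, Prop 3.4 (viii) p.32]

PROOF-ONLY file (nothing is defined, nothing numbered is restated). RC-connectedness is
`ArchFrd.A.isRCConnected` / `N.` / `R.` (`ArchimedeanRCConnected.lean`, abc-iut-L1-t6) and total
epimorphicity — under the standing hypothesis "`D` … totally epimorphic" of Ex. 3.3 (i) — is
`ArchFrd.isTotallyEpimorphic_all` (`ArchimedeanFrobenioidStatements.lean`, abc-iut-L1-t6). This file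
supplies the remaining clause, **complexifiability** (Def. 3.1 (v): every real object `A` receives an
arrow `B → A` from a complex object `B` together with an automorphism `β ∈ Aut_{F_A}(B)` lifting complex
conjugation), for `C = C₀ ×_{D₀} D`, `A`, `N`, `R`, when `D` is complexifiable: over a real object
`(X₀, d)` take the complex object `d′ → d` of `D` with its conjugation-lift `β_D` (Def. 3.1 (v) for
`D`), the object `(Spec π(d′), A_{X₀})` — the base change `A_{X₀}|_{π(d′)}` of Def. 3.1 (iv): the
angular region of a real object is isotropic, hence Galois-stable —, the linear isometry
`(π(d′) → Spec K_{X₀}, 1, 1)` onto `X₀` and the linear isometric automorphism `(π(β_D), 1, 1)`.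
It then BUNDLES the three clauses per tower of Prop. 3.4 (`towerA`, `towerN`, `towerR` of
`ArchimedeanFSM.lean`) in the shape of the first three conjuncts of the typed `Tower.PropVIII`.
No side is taken on [IUTchIII] Cor. 3.12.
-/

namespace Literature.AlgebraicGeometry.Frobenioids

open CategoryTheory
open scoped Pointwise

noncomputable section

namespace ArchFrd

/-! ### `D₀`: an object isomorphic to a real object is real -/

/-- In the skeleton `D₀` an object isomorphic to `Spec ℝ` is `Spec ℝ` (`Hom(Spec ℝ, Spec ℂ) = ∅`).
[cite: MochizukiFrdII2008, §3 p.23] -/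
theorem D0.isReal_of_iso {K L : D0} (i : K ≅ L) (hL : L.IsReal) : K.IsReal := by
  cases K with
  | real => rfl
  | complex =>
    have hL' : L = D0.real := hL
    subst hL'
    exact (D0.isEmpty_hom_real_complex.false i.inv).elim

/-! ### `C₀`: arrows `(b, 1, 1)` out of an object carrying an isotropic angular region -/

namespace C0

variable {X Y Z : C0}

/-- Condition (c) of Ex. 3.3 (i) for the data `(b, 1, 1) : (Spec L, A_X) → X` when `A_X` is isotropic:
`1 · A_X ⊆ A_X|_L`, since an isotropic region is Galois-stable (the base change `A_X|_L` of Def. 3.1 (iv)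
read in `ℂ^×` is `A_X` itself). [cite: MochizukiFrdII2008, Def 3.1 (iv) p.24] -/
theorem one_smul_subset_pullRegion (X : C0) (hX : X.IsNaivelyIsotropic) {L : D0} (b : L ⟶ X.base) :
    (1 : ℂˣ) • X.region.carrier ^ ((1 : ℕ+) : ℕ) ⊆ X.pullRegion b := by
  change (1 : ℂˣ) • X.region.carrier ^ ((1 : ℕ+) : ℕ) ⊆ D0.galAct (D0.Hom.twists b) '' X.region.carrier
  rw [one_smul, PNat.one_coe, pow_one, image_galAct_of_isIsotropic hX]

/-- An arrow `(b, 1, 1)` between objects with the same tip is an isometry.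
[cite: MochizukiFrdII2008, Ex 3.3 (ii) p.28] -/
theorem isIsometry_of_degFr_scalar_eq_one (φ : Y ⟶ X) (h₁ : degFr φ = 1) (h₂ : scalar φ = 1)
    (h₃ : Y.tip = X.tip) : PreFrobenioid.IsIsometry C0.toElem φ := by
  refine (A0.isIsometry_iff_norm_mul_tip_pow _).mpr ?_
  rw [h₁, h₂, h₃, Units.val_one, norm_one, one_mul, PNat.one_coe, pow_one]

/-- `(a, 1, 1) ≫ (b, 1, 1) = (c, 1, 1)` as soon as `a ≫ b = c`. [cite: MochizukiFrdII2008, Ex 3.3 (i) p.27] -/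
theorem comp_eq_of_degFr_scalar_eq_one (ψ : Z ⟶ Y) (φ : Y ⟶ X) (χ : Z ⟶ X)
    (hb : Base ψ ≫ Base φ = Base χ) (hψ₁ : degFr ψ = 1) (hψ₂ : scalar ψ = 1) (hφ₁ : degFr φ = 1)
    (hφ₂ : scalar φ = 1) (hχ₁ : degFr χ = 1) (hχ₂ : scalar χ = 1) : ψ ≫ φ = χ := by
  refine hom_ext hb ?_ ?_
  · rw [degFr_comp', hψ₁, hφ₁, hχ₁, mul_one]
  · rw [scalar_comp', hψ₂, hφ₂, hχ₂, map_one, one_pow, mul_one]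

end C0

universe v u

variable {D : Type u} [Category.{v} D] (π : D ⥤ D0)

/-! ### `C = C₀ ×_{D₀} D`: a complex object with a conjugation-lift over every real object -/

namespace C

/-- Over a real object `X = (X₀, d, ι)` of `C` (with `D` complexifiable): a complex object `B` of `C`, an
arrow `f : B → X` and an automorphism `e` of `B` over `f` lifting complex conjugation — with `f`, `e`,
`e⁻¹` LINEAR ISOMETRIES (so that the same data serve `A` and `N`). Construction: `D` supplies a complex
`g : d′ → d` with `β_D ∈ Aut(d′)`, `β_D ≫ g = g`, `π(β_D) ≠ id`; `B := ((Spec π(d′), A_{X₀}), d′, id)`,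
`f := ((π(g) ≫ ι⁻¹, 1, 1), g)`, `e := ((π(β_D), 1, 1), β_D)`.
[cite: MochizukiFrdII2008, Prop 3.4 (viii) p.32] -/
theorem exists_complex_over_real (hC : RC.IsComplexifiable (π ⋙ D0.toArchBase)) (X : C π)
    (hd : (π.obj X.snd).IsReal) :
    ∃ (B : C π) (f : B ⟶ X) (e : B ≅ B), (π.obj B.snd).IsComplex ∧ e.hom ≫ f = f ∧
      (π ⋙ D0.toArchBase).map e.hom.snd ≠ 𝟙 _ ∧
      PreFrobenioid.IsIsometry (C.toElem π) f ∧ PreFrobenioid.IsIsometry (C.toElem π) e.hom ∧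
      PreFrobenioid.IsIsometry (C.toElem π) e.inv ∧
      C0.degFr f.fst = 1 ∧ C0.degFr e.hom.fst = 1 ∧ C0.degFr e.inv.fst = 1 := by
  obtain ⟨d', g, β, hc, hβg, hne⟩ :=
    hC.exists_complex X.snd ((D0.realObjects_comp_iff π X.snd).mpr hd)
  have hX : X.fst.IsNaivelyIsotropic :=
    C0.isNaivelyIsotropic_of_isRealObj (D0.isReal_of_iso X.iso hd)
  -- the object `(Spec π(d′), A_{X₀})` of `C₀` and its arrows `(π(g) ≫ ι⁻¹, 1, 1)`, `(π(β^{±1}), 1, 1)`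
  let Y : C0 := ⟨π.obj d', X.fst.region, fun _ => hX⟩
  let f₀ : Y ⟶ X.fst :=
    ⟨π.map g ≫ X.iso.inv, 1, 1, one_mem _, C0.one_smul_subset_pullRegion X.fst hX _⟩
  let e₀ : Y ⟶ Y := ⟨π.map β.hom, 1, 1, one_mem _, C0.one_smul_subset_pullRegion Y hX _⟩
  let e₀' : Y ⟶ Y := ⟨π.map β.inv, 1, 1, one_mem _, C0.one_smul_subset_pullRegion Y hX _⟩
  have he : e₀ ≫ e₀' = 𝟙 Y :=
    C0.comp_eq_of_degFr_scalar_eq_one e₀ e₀' (𝟙 Y)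
      (by change π.map β.hom ≫ π.map β.inv = 𝟙 (π.obj d'); rw [← π.map_comp, β.hom_inv_id, π.map_id])
      rfl rfl rfl rfl rfl rfl
  have he' : e₀' ≫ e₀ = 𝟙 Y :=
    C0.comp_eq_of_degFr_scalar_eq_one e₀' e₀ (𝟙 Y)
      (by change π.map β.inv ≫ π.map β.hom = 𝟙 (π.obj d'); rw [← π.map_comp, β.inv_hom_id, π.map_id])
      rfl rfl rfl rfl rfl rfl
  have hef : e₀ ≫ f₀ = f₀ :=
    C0.comp_eq_of_degFr_scalar_eq_one e₀ f₀ f₀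
      (by
        change π.map β.hom ≫ π.map g ≫ X.iso.inv = π.map g ≫ X.iso.inv
        rw [← Category.assoc, ← π.map_comp, hβg])
      rfl rfl rfl rfl rfl rfl
  -- in `C`
  let B : C π := ⟨Y, d', Iso.refl _⟩
  let f : B ⟶ X := ⟨f₀, g, by
    change (π.map g ≫ X.iso.inv) ≫ X.iso.hom = 𝟙 _ ≫ π.map g
    rw [Category.assoc, Iso.inv_hom_id, Category.comp_id, Category.id_comp]⟩
  let e : B ≅ B := CFP.isoMk ⟨e₀, e₀', he, he'⟩ β (by
    change π.map β.hom ≫ 𝟙 _ = 𝟙 _ ≫ π.map β.hom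
    rw [Category.comp_id, Category.id_comp])
  refine ⟨B, f, e, (D0.complexObjects_comp_iff π d').mp hc, CFP.hom_ext hef hβg, hne, ?_, ?_, ?_,
    rfl, rfl, rfl⟩
  · exact C0.isIsometry_of_degFr_scalar_eq_one f₀ rfl rfl rfl
  · exact C0.isIsometry_of_degFr_scalar_eq_one e₀ rfl rfl rfl
  · exact C0.isIsometry_of_degFr_scalar_eq_one e₀' rfl rfl rfl

/-- **`C = C₀ ×_{D₀} D` is complexifiable when `D` is** (Def. 3.1 (v)).
[cite: MochizukiFrdII2008, Prop 3.4 (viii) p.32] -/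
theorem rc_isComplexifiable (hC : RC.IsComplexifiable (π ⋙ D0.toArchBase)) :
    RC.IsComplexifiable (C.toBase π ⋙ π ⋙ D0.toArchBase) := by
  refine ⟨fun X hXr => ?_⟩
  obtain ⟨B, f, e, hc, hef, hne, -⟩ :=
    exists_complex_over_real π hC X ((D0.realObjects_comp_iff (C.toBase π ⋙ π) X).mp hXr)
  exact ⟨B, f, e, (D0.complexObjects_comp_iff (C.toBase π ⋙ π) B).mpr hc, hef, hne⟩

end C

/-! ### `A` (isometries of `C`) and `N` (linear isometries) -/

/-- **`A` is complexifiable when `D` is** (the arrows of `C.exists_complex_over_real` are isometries).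
[cite: MochizukiFrdII2008, Prop 3.4 (viii) p.32] -/
theorem A.rc_isComplexifiable (hC : RC.IsComplexifiable (π ⋙ D0.toArchBase)) :
    RC.IsComplexifiable (A.toBase π ⋙ π ⋙ D0.toArchBase) := by
  refine ⟨fun X hXr => ?_⟩
  obtain ⟨B, f, e, hc, hef, hne, hf, he, he', -⟩ :=
    C.exists_complex_over_real π hC X.obj ((D0.realObjects_comp_iff (A.toBase π ⋙ π) X).mp hXr)
  refine ⟨⟨B⟩, ⟨f, hf⟩, ⟨⟨e.hom, he⟩, ⟨e.inv, he'⟩, WideSubcategory.hom_ext _ e.hom_inv_id,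
    WideSubcategory.hom_ext _ e.inv_hom_id⟩, ?_, WideSubcategory.hom_ext _ hef, hne⟩
  exact (D0.complexObjects_comp_iff (A.toBase π ⋙ π) ⟨B⟩).mpr hc

/-- **`N` is complexifiable when `D` is** (the arrows of `C.exists_complex_over_real` are linear
isometries). [cite: MochizukiFrdII2008, Prop 3.4 (viii) p.32] -/
theorem N.rc_isComplexifiable (hC : RC.IsComplexifiable (π ⋙ D0.toArchBase)) :
    RC.IsComplexifiable (N.toBase π ⋙ π ⋙ D0.toArchBase) := by
  refine ⟨fun X hXr => ?_⟩
  obtain ⟨B, f, e, hc, hef, hne, hf, he, he', hf₁, he₁, he₁'⟩ :=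
    C.exists_complex_over_real π hC X.obj.obj ((D0.realObjects_comp_iff (N.toBase π ⋙ π) X).mp hXr)
  let eA : (⟨B⟩ : A π) ≅ ⟨B⟩ :=
    ⟨⟨e.hom, he⟩, ⟨e.inv, he'⟩, WideSubcategory.hom_ext _ e.hom_inv_id,
      WideSubcategory.hom_ext _ e.inv_hom_id⟩
  refine ⟨⟨⟨B⟩⟩, ⟨⟨f, hf⟩, hf₁⟩, ⟨⟨eA.hom, he₁⟩, ⟨eA.inv, he₁'⟩, WideSubcategory.hom_ext _ eA.hom_inv_id,
    WideSubcategory.hom_ext _ eA.inv_hom_id⟩, ?_, ?_, hne⟩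
  · exact (D0.complexObjects_comp_iff (N.toBase π ⋙ π) ⟨⟨B⟩⟩).mpr hc
  · exact WideSubcategory.hom_ext _ (WideSubcategory.hom_ext _ hef)

/-! ### `R = R₀ ×_{D₀} D` -/

/-- **`R` is complexifiable when `D` is**: over a real `X = (X₀ → A_ℝ, d, ι)` the same `C₀`-data, read in
`N₀` and rigidified through `X₀ → A_ℝ` (an object of `R₀ = (N₀)_{A_ℝ}` with its arrow to `X₀` and its
automorphism over it). [cite: MochizukiFrdII2008, Prop 3.4 (viii) p.32] -/
theorem R.rc_isComplexifiable (hC : RC.IsComplexifiable (π ⋙ D0.toArchBase)) :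
    RC.IsComplexifiable (R.toBase π ⋙ π ⋙ D0.toArchBase) := by
  refine ⟨fun X hXr => ?_⟩
  have hd : (π.obj X.snd).IsReal := (D0.realObjects_comp_iff (R.toBase π ⋙ π) X).mp hXr
  obtain ⟨d', g, β, hc, hβg, hne⟩ :=
    hC.exists_complex X.snd ((D0.realObjects_comp_iff π X.snd).mpr hd)
  have hX : (N0.carrier X.fst.left).IsNaivelyIsotropic :=
    C0.isNaivelyIsotropic_of_isRealObj (D0.isReal_of_iso X.iso hd)
  -- the `C₀`-data
  let Y : C0 := ⟨π.obj d', (N0.carrier X.fst.left).region, fun _ => hX⟩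
  let f₀ : Y ⟶ N0.carrier X.fst.left :=
    ⟨π.map g ≫ X.iso.inv, 1, 1, one_mem _, C0.one_smul_subset_pullRegion _ hX _⟩
  let e₀ : Y ⟶ Y := ⟨π.map β.hom, 1, 1, one_mem _, C0.one_smul_subset_pullRegion Y hX _⟩
  let e₀' : Y ⟶ Y := ⟨π.map β.inv, 1, 1, one_mem _, C0.one_smul_subset_pullRegion Y hX _⟩
  have he : e₀ ≫ e₀' = 𝟙 Y :=
    C0.comp_eq_of_degFr_scalar_eq_one e₀ e₀' (𝟙 Y)
      (by change π.map β.hom ≫ π.map β.inv = 𝟙 (π.obj d'); rw [← π.map_comp, β.hom_inv_id, π.map_id])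
      rfl rfl rfl rfl rfl rfl
  have he' : e₀' ≫ e₀ = 𝟙 Y :=
    C0.comp_eq_of_degFr_scalar_eq_one e₀' e₀ (𝟙 Y)
      (by change π.map β.inv ≫ π.map β.hom = 𝟙 (π.obj d'); rw [← π.map_comp, β.inv_hom_id, π.map_id])
      rfl rfl rfl rfl rfl rfl
  have hef : e₀ ≫ f₀ = f₀ :=
    C0.comp_eq_of_degFr_scalar_eq_one e₀ f₀ f₀
      (by
        change π.map β.hom ≫ π.map g ≫ X.iso.inv = π.map g ≫ X.iso.inv
        rw [← Category.assoc, ← π.map_comp, hβg])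
      rfl rfl rfl rfl rfl rfl
  -- in `N₀`
  let YN : N0 := ⟨⟨Y⟩⟩
  let fN : YN ⟶ X.fst.left := N0.homMk f₀ (C0.isIsometry_of_degFr_scalar_eq_one f₀ rfl rfl rfl) rfl
  let eN : YN ≅ YN :=
    ⟨N0.homMk e₀ (C0.isIsometry_of_degFr_scalar_eq_one e₀ rfl rfl rfl) rfl,
      N0.homMk e₀' (C0.isIsometry_of_degFr_scalar_eq_one e₀' rfl rfl rfl) rfl,
      N0.hom_ext he, N0.hom_ext he'⟩
  have hefN : eN.hom ≫ fN = fN := N0.hom_ext hef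
  -- in `R₀ = (N₀)_{A_ℝ}` and in `R`
  let YR : R0 := Over.mk (fN ≫ X.fst.hom)
  let fR : YR ⟶ X.fst := Over.homMk fN rfl
  let eR : YR ≅ YR := Over.isoMk eN (by
    change eN.hom ≫ fN ≫ X.fst.hom = fN ≫ X.fst.hom
    rw [← Category.assoc, hefN])
  let B : R π := ⟨YR, d', Iso.refl _⟩
  let f : B ⟶ X := ⟨fR, g, by
    change (π.map g ≫ X.iso.inv) ≫ X.iso.hom = 𝟙 _ ≫ π.map g
    rw [Category.assoc, Iso.inv_hom_id, Category.comp_id, Category.id_comp]⟩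
  let e : B ≅ B := CFP.isoMk eR β (by
    change π.map β.hom ≫ 𝟙 _ = 𝟙 _ ≫ π.map β.hom
    rw [Category.comp_id, Category.id_comp])
  refine ⟨B, f, e, (D0.complexObjects_comp_iff (R.toBase π ⋙ π) B).mpr
    ((D0.complexObjects_comp_iff π d').mp hc), CFP.hom_ext (Over.OverMorphism.ext hefN) hβg, hne⟩

/-! ### Proposition 3.4 (viii), first three conclusions, per tower -/

/-- **Prop. 3.4 (viii), clauses "complexifiable, RC-connected, totally epimorphic" for `F = A`**: if `D`
is complexifiable then `A` is complexifiable; if `D` is RC-connected then `A` is RC-connected; if `D` is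
totally epimorphic (standing hypothesis of Ex. 3.3 (i)) then `A` is totally epimorphic — the first three
conjuncts of the typed `(towerA π).PropVIII`, each under exactly the matching hypothesis on `D`.
[cite: MochizukiFrdII2008, Prop 3.4 (viii) p.32] -/
theorem towerA_complexifiable_rcConnected_totallyEpimorphic :
    (RC.IsComplexifiable (π ⋙ D0.toArchBase) →
        RC.IsComplexifiable ((towerA π).toD0 ⋙ D0.toArchBase)) ∧
      (RC.IsRCConnected (π ⋙ D0.toArchBase) → RC.IsRCConnected ((towerA π).toD0 ⋙ D0.toArchBase)) ∧
        (IsTotallyEpimorphic D → IsTotallyEpimorphic (towerA π).F) :=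
  ⟨A.rc_isComplexifiable π, A.isRCConnected π, fun hD => (isTotallyEpimorphic_all π hD).2.1⟩

/-- **Prop. 3.4 (viii), clauses "complexifiable, RC-connected, totally epimorphic" for `F = N`.**
[cite: MochizukiFrdII2008, Prop 3.4 (viii) p.32] -/
theorem towerN_complexifiable_rcConnected_totallyEpimorphic :
    (RC.IsComplexifiable (π ⋙ D0.toArchBase) →
        RC.IsComplexifiable ((towerN π).toD0 ⋙ D0.toArchBase)) ∧
      (RC.IsRCConnected (π ⋙ D0.toArchBase) → RC.IsRCConnected ((towerN π).toD0 ⋙ D0.toArchBase)) ∧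
        (IsTotallyEpimorphic D → IsTotallyEpimorphic (towerN π).F) :=
  ⟨N.rc_isComplexifiable π, N.isRCConnected π, fun hD => (isTotallyEpimorphic_all π hD).2.2.1⟩

/-- **Prop. 3.4 (viii), clauses "complexifiable, RC-connected, totally epimorphic" for `F = R`.**
[cite: MochizukiFrdII2008, Prop 3.4 (viii) p.32] -/
theorem towerR_complexifiable_rcConnected_totallyEpimorphic :
    (RC.IsComplexifiable (π ⋙ D0.toArchBase) →
        RC.IsComplexifiable ((towerR π).toD0 ⋙ D0.toArchBase)) ∧
      (RC.IsRCConnected (π ⋙ D0.toArchBase) → RC.IsRCConnected ((towerR π).toD0 ⋙ D0.toArchBase)) ∧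
        (IsTotallyEpimorphic D → IsTotallyEpimorphic (towerR π).F) :=
  ⟨R.rc_isComplexifiable π, R.isRCConnected π, fun hD => (isTotallyEpimorphic_all π hD).2.2.2⟩

end ArchFrd

end

end Literature.AlgebraicGeometry.Frobenioids
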